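import Summits.BirchSwinnertonDyer.BirchSwinnertonDyer.Theorems.ResidualThetaTransportAtTwoHeckeThetaPartnerAdicAtTwoHeckeThetaAssembly
import Summits.BirchSwinnertonDyer.BirchSwinnertonDyer.Theorems.ResidualThetaTransportAtTwoHeckeThetaPartnerAdicAtTwoKroneckerGlue
import Literature.NumberTheory.EllipticCurves.CMNewformHeckeEigenformProofs
import Literature.NumberTheory.EllipticCurves.MurtySinhaMultiplicityHeckeProofs
import Literature.NumberTheory.EllipticCurves.NewformsProofs
import Literature.NumberTheory.ModularForms.QExpansionDerivative
import Literature.NumberTheory.Automorphic.CDTTheorem722SerreProofs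
import Literature.NumberTheory.Automorphic.LanglandsTunnellLSeriesProofs
import Literature.NumberTheory.Automorphic.Sweep1
import Literature.NumberTheory.GaloisRepresentations.PrimaryGeneratorHeckeCharacter
import HarnessLib

/-!
# The CM newform on `Γ₀(N)` of a weight-two Größencharakter with trivial Nebentypus
# (the `k = 2` case of Ribet 1977 §3, PROVED) (toward K0⁺, stmt-20690)

Route `ResidualThetaTransportAtTwo`, crux K0⁺ `HeckeThetaPartnerAdicAtTwo` (stmt-BirchSwinnertonDyer-20690),
line "Hecke theta series from the genus-two Riemann theta function".  THEOREMS ONLY.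

`ribet_cmNewform_gamma0_two`: the statement of the named fact
`Ribet1977_cmNewform_gamma0_of_isGrossencharakter` (`Literature/NumberTheory/EllipticCurves/
CMNewformGamma0OfGrossencharakter.lean`) AT `k = 2`, now a theorem: Hecke's theta series
`θ_ψ ∈ S₂(Γ₀(|d_K| N𝔪))` (`exists_heckeTheta_cuspForm`) has `q`-expansion `Σ_{(𝔞,𝔪)=1} ψ̃(𝔞) q^{N𝔞}`,
is a `T_p`-eigenform and yields a newform (`exists_isNewform1_of_cm_qExpansion`), of trivial character,
hence on `Γ₀` (`exists_isNewform0_coe_eq_of_nebentypus_eq_one`), with CM by the Kronecker character.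

BSD is not proved by this file.
-/

set_option autoImplicit false
set_option linter.dupNamespace false

noncomputable section

open scoped NumberField ComplexConjugate Real MatrixGroups UpperHalfPlane ModularForm nonZeroDivisors
open NumberField Module Complex Filter IsDedekindDomain CongruenceSubgroup
open UpperHalfPlane hiding I

namespace Summit.BirchSwinnertonDyer.BirchSwinnertonDyer.Theorems.HeckeTheta

open Literature.NumberTheory.LFunctions (idealPow rayClassCoeff)
open Literature.NumberTheory.GaloisRepresentations (IsGrossencharakter embType embTypeConj
  prod_embedding_zpow_embType)
open Literature.NumberTheory.EllipticCurves.ModularForms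
open Literature.NumberTheory.Automorphic (IsCMForm)

variable {K : Type} [Field K] [NumberField K]

/-! ### The Größencharakter relation at weight two -/

/-- The weight-two relation `ψ̃((b)) = ψ̃((c)) σ(b/c)` on the ray, from `IsGrossencharakter` with the
infinity type `(1, 0)` at `σ` (an imaginary quadratic field has no real place). -/
theorem idealPow_span_eq_of_isGrossencharakter [IsTotallyComplex K] (σ : K →+* ℂ) {𝔪 : Ideal (𝓞 K)}
    {ψ : HeightOneSpectrum (𝓞 K) → ℂ} (hψG : IsGrossencharakter 𝔪 (embType σ) (embTypeConj σ) ψ)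
    (b c : 𝓞 K) (hb : b ≠ 0) (hc : c ≠ 0) (hcop : IsCoprime (Ideal.span {c}) 𝔪) (hbc : b - c ∈ 𝔪) :
    idealPow K ψ (Ideal.span {b}) = idealPow K ψ (Ideal.span {c}) * σ ((b : K) / c) := by
  have hpos : ∀ φ : K →+* ℝ, 0 < φ b * φ c := by
    intro φ
    exfalso
    refine NumberField.IsTotallyComplex.complexEmbedding_not_isReal ((algebraMap ℝ ℂ).comp φ) ?_
    rw [NumberField.ComplexEmbedding.isReal_iff]
    ext x
    simp [NumberField.ComplexEmbedding.conjugate_coe_eq]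
  rw [hψG.idealPow_span_eq b c hb hc hcop hbc hpos, prod_embedding_zpow_embType]

/-- The modulus of a weight-two Größencharakter is not `1` (`ψ̃((-1)) = -ψ̃((1))` is impossible). -/
theorem modulus_ne_top_of_isGrossencharakter [IsTotallyComplex K] (σ : K →+* ℂ) {𝔪 : Ideal (𝓞 K)}
    {ψ : HeightOneSpectrum (𝓞 K) → ℂ} (hψG : IsGrossencharakter 𝔪 (embType σ) (embTypeConj σ) ψ) :
    𝔪 ≠ ⊤ := by
  intro h𝔪
  have h := idealPow_span_eq_of_isGrossencharakter σ hψG (-1) 1 (by simp) one_ne_zero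
    (by rw [Ideal.span_singleton_one, ← Ideal.one_eq_top]; exact isCoprime_one_left) (by rw [h𝔪]; trivial)
  rw [Ideal.span_singleton_neg, Ideal.span_singleton_one, Literature.NumberTheory.LFunctions.idealPow_top] at h
  norm_num at h

/-! ### The `k = 2` case of Ribet's theorem -/

/-- **The CM newform on `Γ₀(N)`, `N ∣ |d_K|·N𝔪`, of a weight-two Größencharakter with trivial
Nebentypus** — the `k = 2` instance of `Ribet1977_cmNewform_gamma0_of_isGrossencharakter`, proved via
Hecke's theta series. -/
theorem ribet_cmNewform_gamma0_two (K : Type) [Field K] [NumberField K] (hK : finrank ℚ K = 2)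
    (htc : IsTotallyComplex K) (σ : K →+* ℂ) (𝔪 : Ideal (𝓞 K)) (h𝔪 : 𝔪 ≠ ⊥)
    (ψ : HeightOneSpectrum (𝓞 K) → ℂ) (hψG : IsGrossencharakter 𝔪 (embType σ) (embTypeConj σ) ψ)
    (hneb : ∀ n : ℕ, Odd n → n.Coprime ((discr K).natAbs * Ideal.absNorm 𝔪) →
      idealPow K ψ (Ideal.span {(n : 𝓞 K)}) = (jacobiSym (discr K) n : ℂ) * (n : ℂ) ^ (2 - 1)) :
    ∃ (N : ℕ) (_ : NeZero N) (g : CuspForm (Gamma0 N) 2),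
      N ∣ (discr K).natAbs * Ideal.absNorm 𝔪 ∧ IsNewform0 g ∧ IsCMForm (liftToGamma1 N 2 g) ∧
      ∀ p : ℕ, p.Prime → ¬ p ∣ (discr K).natAbs * Ideal.absNorm 𝔪 →
        cuspCoeff g p = ∑ᶠ (v : HeightOneSpectrum (𝓞 K)) (_ : Ideal.absNorm v.asIdeal = p), ψ v := by
  classical
  haveI := htc
  haveI : NeZero (discr K).natAbs := ⟨Int.natAbs_ne_zero.mpr (NumberField.discr_ne_zero K)⟩
  have hM : Ideal.absNorm 𝔪 ≠ 0 := by rw [Ne, Ideal.absNorm_eq_zero_iff]; exact h𝔪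
  haveI hN₀ : NeZero ((discr K).natAbs * Ideal.absNorm 𝔪) := ⟨mul_ne_zero (NeZero.ne _) hM⟩
  -- the Kronecker character and the Größencharakter data
  obtain ⟨κ, hprim, hodd, hquad, hκJ, hζ⟩ := exists_kroneckerChar_imQuad (K := K) hK
  have hψ := idealPow_span_eq_of_isGrossencharakter σ hψG
  have hψ0 : ∀ v : HeightOneSpectrum (𝓞 K), ¬ 𝔪 ≤ v.asIdeal → ψ v ≠ 0 := hψG.ne_zero
  have h𝔪1 := modulus_ne_top_of_isGrossencharakter σ hψG
  have hneb' : ∀ n : ℕ, Odd n → n.Coprime ((discr K).natAbs * Ideal.absNorm 𝔪) →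
      idealPow K ψ (Ideal.span {(n : 𝓞 K)}) = (jacobiSym (discr K) n : ℂ) * (n : ℂ) := by
    intro n hn hc; rw [hneb n hn hc]; norm_num
  -- the theta series
  set N₀ : ℕ := (discr K).natAbs * Ideal.absNorm 𝔪 with hN₀def
  obtain ⟨g₀, hg₀⟩ := exists_heckeTheta_cuspForm hK σ hprim hodd hquad hκJ hζ h𝔪 h𝔪1 hψ0 hψ hneb'
  set g₁ : CuspForm (Gamma1 N₀) 2 := liftToGamma1 N₀ 2 g₀ with hg₁
  have hcoe₁ : (⇑g₁ : ℍ → ℂ) = ⇑g₀ := coe_liftToGamma1_holds N₀ 2 g₀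
  have hgχ : g₁ ∈ nebentypusSubspace N₀ 2 1 := MurtySinha.liftToGamma1_mem_nebentypusSubspace_one N₀ 2 g₀
  -- the `q`-expansion
  have hq : ∀ n : ℕ, (qExpansion 1 ⇑g₁).coeff n =
      ∑ᶠ I ∈ {I : Ideal (𝓞 K) | Ideal.absNorm I = n}, rayClassCoeff 𝔪 ψ I := by
    intro n
    refine Literature.NumberTheory.ModularForms.qExpansion_coeff_eq_of_hasSum
      (c := fun n => ∑ᶠ I ∈ {I : Ideal (𝓞 K) | Ideal.absNorm I = n}, rayClassCoeff 𝔪 ψ I)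
      (SlashInvariantFormClass.periodic_comp_ofComplex g₁ (HeckeTGamma1.one_mem_strictPeriods_Gamma1 N₀))
      (ModularFormClass.holo g₁) (ModularFormClass.bdd_at_infty g₁) (fun τ => ?_) n
    rw [hcoe₁]
    refine (hg₀ τ).congr_fun fun m => ?_
    rw [smul_eq_mul, Function.Periodic.qParam]
    congr 2
    push_cast
    ring_nf
  have hq' : ∀ n : ℕ, 0 < n → (qExpansion 1 ⇑g₁).coeff n =
      ∑ᶠ I ∈ {I : Ideal (𝓞 K) | Ideal.absNorm I = n}, rayClassCoeff 𝔪 ψ I := fun n _ => hq n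
  have hg0 : g₁ ≠ 0 := by
    intro h
    have h1 := hq 1
    rw [h] at h1
    have hset : {I : Ideal (𝓞 K) | Ideal.absNorm I = 1} = {⊤} := by
      ext I; simp [Ideal.absNorm_eq_one_iff]
    rw [hset, finsum_mem_singleton, rayClassCoeff_top] at h1
    have : (qExpansion 1 (⇑(0 : CuspForm (Gamma1 N₀) 2))).coeff 1 = 0 := by
      rw [CuspForm.coe_zero, UpperHalfPlane.qExpansion_zero]; simp
    rw [this] at h1
    exact zero_ne_one h1
  -- places over primes away from the level
  have hunr : ∀ v : HeightOneSpectrum (𝓞 ℚ), ¬ Rat.HeightOneSpectrum.natGenerator v ∣ N₀ →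
      v.asIdeal.ramificationIdxIn (𝓞 K) = 1 := fun v hv =>
    ramificationIdxIn_eq_one_of_not_dvd_level K v (dvd_mul_right _ _) hv
  have hwv : ∀ {v : HeightOneSpectrum (𝓞 ℚ)} {w : HeightOneSpectrum (𝓞 K)},
      w.asIdeal.under (𝓞 ℚ) = v.asIdeal → w.under (𝓞 ℚ) = v := fun hw =>
    HeightOneSpectrum.ext (by rw [HeightOneSpectrum.under_asIdeal]; exact hw)
  have hcop : ∀ v : HeightOneSpectrum (𝓞 ℚ), ¬ Rat.HeightOneSpectrum.natGenerator v ∣ N₀ →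
      ∀ w : HeightOneSpectrum (𝓞 K), w.asIdeal.under (𝓞 ℚ) = v.asIdeal → IsCoprime w.asIdeal 𝔪 := by
    intro v hv w hw
    rw [Ideal.isCoprime_iff_sup_eq]
    by_contra hne
    have hle : 𝔪 ≤ w.asIdeal := by
      have hmax := w.isMaximal
      rcases hmax.eq_of_le (J := w.asIdeal ⊔ 𝔪) (fun h => hne h) le_sup_left with h
      exact h ▸ le_sup_right
    have hdvd : Ideal.absNorm w.asIdeal ∣ Ideal.absNorm 𝔪 := Ideal.absNorm_dvd_absNorm_of_le hle
    have hp : Rat.HeightOneSpectrum.natGenerator v ∣ Ideal.absNorm w.asIdeal := by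
      rw [absNorm_asIdeal_eq_natGenerator_pow, hwv hw]
      exact dvd_pow_self _ (Ideal.inertiaDeg_pos (R := 𝓞 ℚ) (q := w.asIdeal)).ne'
    exact hv ((hp.trans hdvd).trans (dvd_mul_left _ _))
  -- `ψ̃((p)) = κ(p) p`, `κ(p) = ±1` according to the splitting of `p`
  have hψp : ∀ v : HeightOneSpectrum (𝓞 ℚ), ¬ Rat.HeightOneSpectrum.natGenerator v ∣ N₀ →
      idealPow K ψ (Ideal.span {((Rat.HeightOneSpectrum.natGenerator v : ℕ) : 𝓞 K)}) =
        κ (Rat.HeightOneSpectrum.natGenerator v) * Rat.HeightOneSpectrum.natGenerator v := fun v hv =>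
    idealPow_span_prime_eq hK σ hodd hquad hκJ h𝔪 hψ hneb' (Rat.HeightOneSpectrum.prime_natGenerator v) hv
  have hone : ∀ v : HeightOneSpectrum (𝓞 ℚ), ¬ Rat.HeightOneSpectrum.natGenerator v ∣ N₀ →
      (1 : DirichletCharacter ℂ N₀) (Rat.HeightOneSpectrum.natGenerator v : ZMod N₀) = 1 := by
    intro v hv
    have hu : IsUnit (Rat.HeightOneSpectrum.natGenerator v : ZMod N₀) :=
      (ZMod.isUnit_iff_coprime _ _).mpr
        ((Nat.Prime.coprime_iff_not_dvd (Rat.HeightOneSpectrum.prime_natGenerator v)).mpr hv)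
    exact MulChar.one_apply hu
  have hsplit : ∀ v : HeightOneSpectrum (𝓞 ℚ), ¬ Rat.HeightOneSpectrum.natGenerator v ∣ N₀ →
      (∃ w₁ w₂ : HeightOneSpectrum (𝓞 K), w₁ ≠ w₂ ∧
        w₁.asIdeal.under (𝓞 ℚ) = v.asIdeal ∧ w₂.asIdeal.under (𝓞 ℚ) = v.asIdeal) →
      (1 : DirichletCharacter ℂ N₀) (Rat.HeightOneSpectrum.natGenerator v : ZMod N₀) *
          (Rat.HeightOneSpectrum.natGenerator v : ℂ) ^ ((2 : ℤ) - 1) =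
        idealPow K ψ (Ideal.span {((Rat.HeightOneSpectrum.natGenerator v : ℕ) : 𝓞 K)}) := by
    intro v hv hpair
    rw [hone v hv, hψp v hv]
    rcases exists_places_eq_pair_or_eq_singleton hK v (hunr v hv) with
      ⟨w₁, w₂, hne, hS, h₁, h₂⟩ | ⟨w, hS, hw⟩
    · rw [kroneckerChar_eq_of_pair hζ v hne hS h₁ h₂]; norm_num
    · exfalso
      obtain ⟨w₁, w₂, hne, hw₁, hw₂⟩ := hpair
      have h1 : w₁ ∈ ({w} : Set (HeightOneSpectrum (𝓞 K))) := by rw [← hS]; exact hw₁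
      have h2 : w₂ ∈ ({w} : Set (HeightOneSpectrum (𝓞 K))) := by rw [← hS]; exact hw₂
      rw [Set.mem_singleton_iff] at h1 h2
      exact hne (h1.trans h2.symm)
  have hinert : ∀ v : HeightOneSpectrum (𝓞 ℚ), ¬ Rat.HeightOneSpectrum.natGenerator v ∣ N₀ →
      (∃ w : HeightOneSpectrum (𝓞 K), w.asIdeal.under (𝓞 ℚ) = v.asIdeal ∧
        w.asIdeal.inertiaDeg (𝓞 ℚ) = 2) →
      (1 : DirichletCharacter ℂ N₀) (Rat.HeightOneSpectrum.natGenerator v : ZMod N₀) *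
          (Rat.HeightOneSpectrum.natGenerator v : ℂ) ^ ((2 : ℤ) - 1) =
        -idealPow K ψ (Ideal.span {((Rat.HeightOneSpectrum.natGenerator v : ℕ) : 𝓞 K)}) := by
    intro v hv hsing
    rw [hone v hv, hψp v hv]
    rcases exists_places_eq_pair_or_eq_singleton hK v (hunr v hv) with
      ⟨w₁, w₂, hne, hS, h₁, h₂⟩ | ⟨w, hS, hw⟩
    · exfalso
      obtain ⟨w, hwv', hf⟩ := hsing
      have hmem : w ∈ ({w₁, w₂} : Set (HeightOneSpectrum (𝓞 K))) := by rw [← hS]; exact hwv'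
      rcases hmem with h | h
      · rw [h, h₁] at hf; norm_num at hf
      · rw [Set.mem_singleton_iff] at h; rw [h, h₂] at hf; norm_num at hf
    · rw [kroneckerChar_eq_of_singleton hζ v hS hw]; norm_num
  -- the newform on `Γ₁`
  obtain ⟨M₀, hM₀ne, hM₀, g₂, hnew1, hpack, hchar⟩ :=
    exists_isNewform1_of_cm_qExpansion hK 𝔪 ψ hg0 hgχ hq' hunr hcop hsplit hinert
  haveI := hM₀ne
  have hε : nebentypus g₂ = 1 := (DirichletCharacter.changeLevel_eq_one_iff hM₀).mp hchar
  -- descent to `Γ₀`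
  obtain ⟨g₃, hnew0, hcoe₃⟩ :=
    Literature.NumberTheory.Automorphic.BCDT.exists_isNewform0_coe_eq_of_nebentypus_eq_one hnew1 hε
  have hlift : liftToGamma1 M₀ 2 g₃ = g₂ :=
    DFunLike.coe_injective ((coe_liftToGamma1_holds M₀ 2 g₃).trans hcoe₃)
  refine ⟨M₀, hM₀ne, g₃, hM₀, hnew0, ?_, fun p hp hpN => ?_⟩
  · -- complex multiplication by `κ`
    rw [hlift]
    refine ⟨(discr K).natAbs, κ, ?_, ?_⟩
    · intro h1
      have := hodd
      rw [h1] at this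
      change (1 : DirichletCharacter ℂ (discr K).natAbs) (-1) = -1 at this
      rw [MulChar.one_apply (isUnit_one.neg)] at this
      norm_num at this
    · rw [Filter.eventually_cofinite]
      refine (Nat.divisors N₀).finite_toSet.subset fun p hp => ?_
      simp only [Set.mem_setOf_eq, Classical.not_imp] at hp
      obtain ⟨hpp, hne⟩ := hp
      rw [Finset.mem_coe, Nat.mem_divisors]
      refine ⟨?_, NeZero.ne _⟩
      by_contra hpN
      apply hne
      -- `p ∤ N₀`: read `p` as a place `v`
      obtain ⟨v, hv⟩ : ∃ v : HeightOneSpectrum (𝓞 ℚ), Rat.HeightOneSpectrum.natGenerator v = p :=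
        ⟨(Rat.HeightOneSpectrum.primesEquiv (R := 𝓞 ℚ)).symm ⟨p, hpp⟩,
          congrArg Subtype.val ((Rat.HeightOneSpectrum.primesEquiv (R := 𝓞 ℚ)).apply_symm_apply _)⟩
      subst hv
      rw [IsNewform1.heckeEigenvalue_eq_coeff_holds hnew1 hpp]
      change κ _ * cuspCoeff g₂ _ = cuspCoeff g₂ _
      rw [hpack _ hpp hpN]
      rcases exists_places_eq_pair_or_eq_singleton hK v (hunr v hpN) with
        ⟨w₁, w₂, hne', hS, h₁, h₂⟩ | ⟨w, hS, hw⟩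
      · rw [kroneckerChar_eq_of_pair hζ v hne' hS h₁ h₂, one_mul]
      · rw [finsum_mem_setOf_absNorm_eq_of_singleton v hS hw, mul_zero]
  · -- the prime coefficients
    obtain ⟨v, hv⟩ : ∃ v : HeightOneSpectrum (𝓞 ℚ), Rat.HeightOneSpectrum.natGenerator v = p :=
      ⟨(Rat.HeightOneSpectrum.primesEquiv (R := 𝓞 ℚ)).symm ⟨p, hp⟩,
        congrArg Subtype.val ((Rat.HeightOneSpectrum.primesEquiv (R := 𝓞 ℚ)).apply_symm_apply _)⟩
    subst hv
    have hc₃ : cuspCoeff g₃ (Rat.HeightOneSpectrum.natGenerator v) =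
        cuspCoeff g₂ (Rat.HeightOneSpectrum.natGenerator v) := by
      simp only [cuspCoeff, hcoe₃]
    rw [hc₃, hpack _ hp hpN]
    change _ = ∑ᶠ w ∈ {w : HeightOneSpectrum (𝓞 K) |
      Ideal.absNorm w.asIdeal = Rat.HeightOneSpectrum.natGenerator v}, ψ w
    rcases exists_places_eq_pair_or_eq_singleton hK v (hunr v hpN) with
      ⟨w₁, w₂, hne', hS, h₁, h₂⟩ | ⟨w, hS, hw⟩
    · have hm₁ : w₁ ∈ {w : HeightOneSpectrum (𝓞 K) | w.asIdeal.under (𝓞 ℚ) = v.asIdeal} := by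
        rw [hS]; exact Set.mem_insert _ _
      have hm₂ : w₂ ∈ {w : HeightOneSpectrum (𝓞 K) | w.asIdeal.under (𝓞 ℚ) = v.asIdeal} := by
        rw [hS]; exact Set.mem_insert_of_mem _ rfl
      have hset : {w : HeightOneSpectrum (𝓞 K) |
          Ideal.absNorm w.asIdeal = Rat.HeightOneSpectrum.natGenerator v} = {w₁, w₂} := by
        ext w
        have h := congrArg (fun S : Set (Ideal (𝓞 K)) => w.asIdeal ∈ S) (setOf_absNorm_eq_of_pair v hS h₁ h₂)
        simp only [Set.mem_setOf_eq, Set.mem_insert_iff, Set.mem_singleton_iff, eq_iff_iff] at h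
        simp only [Set.mem_setOf_eq, Set.mem_insert_iff, Set.mem_singleton_iff]
        rw [h, HeightOneSpectrum.ext_iff, HeightOneSpectrum.ext_iff]
      rw [finsum_mem_setOf_absNorm_eq_of_pair v hne' hS h₁ h₂,
        rayClassCoeff_asIdeal_of_isCoprime _ _ (hcop v hpN w₁ hm₁),
        rayClassCoeff_asIdeal_of_isCoprime _ _ (hcop v hpN w₂ hm₂), hset,
        finsum_mem_pair hne']
    · have hset : {w : HeightOneSpectrum (𝓞 K) |
          Ideal.absNorm w.asIdeal = Rat.HeightOneSpectrum.natGenerator v} = ∅ := by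
        ext w'
        have h := congrArg (fun S : Set (Ideal (𝓞 K)) => w'.asIdeal ∈ S) (setOf_absNorm_eq_of_singleton v hS hw)
        simp only [Set.mem_setOf_eq, Set.mem_empty_iff_false, eq_iff_iff] at h
        simp only [Set.mem_setOf_eq, Set.mem_empty_iff_false, iff_false]
        exact fun h' => h.mp h'
      rw [finsum_mem_setOf_absNorm_eq_of_singleton v hS hw, hset, finsum_mem_empty]

end Summit.BirchSwinnertonDyer.BirchSwinnertonDyer.Theorems.HeckeTheta

end
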